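import Summits.ResolutionOfSingularities.ResolutionOfSingularities.Theorems.WildConesCampaignW46HypersurfacesCharTwoSuccessorCorank
import Summits.ResolutionOfSingularities.ResolutionOfSingularities.Theorems.WildConesCampaignW46HypersurfacesCharTwoHilbertThreeIff

/-!
# [OURS · L1 W4.6, rung (ii) at p = 2, EVERY dimension n] AT MOST ONE SATELLITE: for a corank-two double
# point with `h₂ ≤ 2` the singular directions of the tangent cubic on the kernel plane — the near points
# whose successor has corank two again — are pairwise proportional (at most ONE such point of `ℙ¹`), and
# there is NONE when `h₂ = 1` — `z² = a(u₁,…,uₙ)` over every field of characteristic 2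

HONEST FRAMING. Everything here is OURS: theorems about route WildCones' own TYPED point-blow-up dynamics
(`Theorems/WildConesClassicalRegimesDefs.lean`) and the seat's invariants `polarMatrix` (p502936),
`milnorEmbDim` (p498937), `milnorHilbertTwo` (p511581), `degForm` (p522667). NOTHING here is a statement
of the manuscript [Hironaka2017]; no FACT-LIST premise; AI review is weaker than expert review. Cell
res-hironaka (LADDER-RESOLUTION rung L, D-0089), slot W4.6, seat res-L1-s46-pv-4 (gen 5); host route
`WildCones`, crux `ClassicalRegimes` (stmt-ResolutionOfSingularities-16884; proved).

THE ARGUMENT. POLARIZATION (`degForm_two_add`): for every series `g` and vectors `v, v'`,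
`g₂(v + v') = g₂(v) + g₂(v') + Σₛ vₛ (∂ₛ g)₁(v')` (both sides collect `[X_sX_t]g · (v_s v'_t + v'_s v_t)`).
In characteristic two the second directional derivative `D_w D_w a` VANISHES (`∂ₛ∂ₛ = 0`, mixed partials
cancel in pairs), so the symmetric trilinear form `T(λ, v, v') = Σₛ vₛ (∂ₛ D_λ a)₁(v')` satisfies
`T(w, w, x) = 0`, and `T` is symmetric in its first two slots (mixed partials commute). Hence, if
`w₁, w₂` are two SINGULAR directions of the cubic on the kernel plane `K = ⟨w₁, w₂⟩` (all kernel polars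
vanish at `w₁` and at `w₂`), then every polar `Σₛ λₛ (∂ₛa)₂(v)`, `λ, v ∈ K`, vanishes: expand
`v = a w₁ + b w₂` by polarization; the cross term `T(λ, w₁, w₂)` is `T(w₁,w₁,w₂) = 0` or
`T(w₂, w₁, w₂) = T(w₁, w₂, w₂) = T(w₂, w₂, w₁) = 0`. By the converse link (p531822) `h₂ = 3`.

WHAT IS PROVED (every `n`, every field of characteristic `2`):

* `degForm_two_add` — the polarization identity; `sum_C_mul_pderiv_sum_C_mul_pderiv_self` — `D_w D_w a = 0`;
* `hypersurface_two_satellites_milnorHilbertTwo_eq_three` — `e = 2`, two non-proportional singular kernel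
  directions ⇒ `h₂ = 3`; `hypersurface_satellite_unique` — `h₂ ≤ 2` ⇒ singular kernel directions are
  proportional: AT MOST ONE SATELLITE near point, the corank-two chain continues at ≤ 1 point;
* `hypersurface_no_satellite_of_milnorHilbertTwo_eq_one` — `h₂ = 1` (isolated) ⇒ NO non-zero singular
  kernel direction: every near point is free (successor `μ = 1`), as gen 4's three-tangents theorem says.

References: [CasasAlvero2000] §3 (free/satellite points: context); [GreuelPfister2026] (context);
[Hironaka2017] Th. 16.6 p.84 — role replaced only, under adjudication.
-/

noncomputable section

-- single-problem summit: the doubled namespace component `ResolutionOfSingularities` is forced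
set_option linter.dupNamespace false

open scoped BigOperators Classical

open MvPowerSeries IsLocalRing

open Literature.AlgebraicGeometry.Resolution

namespace Summit.ResolutionOfSingularities.ResolutionOfSingularities.Theorems

namespace CampaignW46.HypersurfacesCharTwo

open WildCones WildCones.MuDropCharTwoOrdP ThreefoldsCharTwo

variable {κ : Type} [Field κ] {n : ℕ}

/-! ## Polarization of the quadratic form -/

/-- [OURS · L1 W4.6] An exponent of degree two is `e_a + e_b`. [folklore] -/
theorem exists_pair_of_degree_two {A : Fin n →₀ ℕ} (hA : A.degree = 2) :
    ∃ a b : Fin n, A = Finsupp.single a 1 + Finsupp.single b 1 := by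
  have hne : A ≠ 0 := fun h => by rw [h, map_zero] at hA; exact two_ne_zero hA.symm
  obtain ⟨a, ha⟩ := Finsupp.ne_iff.mp hne
  rw [Finsupp.zero_apply] at ha
  have hle : Finsupp.single a 1 ≤ A := Finsupp.single_le_iff.mpr (Nat.one_le_iff_ne_zero.mpr ha)
  have hdeg : (A - Finsupp.single a 1).degree = 1 := by
    have h := congrArg Finsupp.degree (tsub_add_cancel_of_le hle)
    rw [map_add, Finsupp.degree_single, hA] at h
    omega
  obtain ⟨b, hb⟩ := exists_eq_single_of_degree_eq_one hdeg
  exact ⟨a, b, by rw [← tsub_add_cancel_of_le hle, ← hb, add_comm]⟩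

/-- [OURS · L1 W4.6] The monomial function of `e_a + e_b` is `w_a w_b`. [folklore] -/
theorem prod_pow_single_add_single (w : Fin n → κ) (a b : Fin n) :
    ∏ u, w u ^ ((Finsupp.single a 1 + Finsupp.single b 1 : Fin n →₀ ℕ) u) = w a * w b := by
  rw [prod_pow_add_single w (Finsupp.single a 1) b,
    show (Finsupp.single a 1 : Fin n →₀ ℕ) = 0 + Finsupp.single a 1 by rw [zero_add], prod_pow_add_single]
  simp only [Finsupp.coe_zero, Pi.zero_apply, pow_zero, Finset.prod_const_one, mul_one]
  ring

/-- [OURS · L1 W4.6] The fibre sum of the polarization: for `A = e_a + e_b`,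
`Σ_{s,t : e_s + e_t = A} (δ_{ts} + 1) v_s v'_t = v_a v'_b + v'_a v_b`. [folklore] -/
theorem sum_pair_fiber (v v' : Fin n → κ) (a b : Fin n) :
    ∑ s, ∑ t, (if Finsupp.single t 1 + Finsupp.single s 1 = (Finsupp.single a 1 + Finsupp.single b 1 : Fin n →₀ ℕ)
      then ((((Finsupp.single t 1 : Fin n →₀ ℕ) s : ℕ) : κ) + 1) * (v s * v' t) else 0) =
      v a * v' b + v' a * v b := by
  have hiff : ∀ s t : Fin n, (Finsupp.single t 1 + Finsupp.single s 1 =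
      (Finsupp.single a 1 + Finsupp.single b 1 : Fin n →₀ ℕ)) ↔ (t = a ∧ s = b) ∨ (t = b ∧ s = a) := by
    intro s t
    rw [Finsupp.single_add_single_eq_single_add_single one_ne_zero one_ne_zero]
    constructor
    · rintro (h | ⟨-, h1, h2⟩ | ⟨h, -, -⟩)
      · exact Or.inl h
      · exact Or.inr ⟨h1, h2⟩
      · exact absurd h (by norm_num)
    · rintro (h | ⟨h1, h2⟩)
      · exact Or.inl h
      · exact Or.inr (Or.inl ⟨rfl, h1, h2⟩)
  simp_rw [hiff]
  by_cases hab : a = b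
  · subst hab
    rw [Finset.sum_eq_single a, Finset.sum_eq_single a]
    · rw [if_pos (Or.inl ⟨rfl, rfl⟩), Finsupp.single_eq_same, Nat.cast_one]; ring
    · intro t _ ht; rw [if_neg (by tauto)]
    · intro h; exact absurd (Finset.mem_univ a) h
    · intro s _ hs
      exact Finset.sum_eq_zero fun t _ => by rw [if_neg (by tauto)]
    · intro h; exact absurd (Finset.mem_univ a) h
  · have hba : b ≠ a := Ne.symm hab
    rw [← Finset.add_sum_erase _ _ (Finset.mem_univ b), Finset.sum_eq_single a, if_pos (Or.inl ⟨rfl, rfl⟩),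
      Finsupp.single_apply, if_neg hab, Nat.cast_zero, zero_add, one_mul,
      ← Finset.add_sum_erase _ _ (Finset.mem_erase.mpr ⟨hab, Finset.mem_univ a⟩),
      Finset.sum_eq_single b, if_pos (Or.inr ⟨rfl, rfl⟩), Finsupp.single_apply, if_neg hba, Nat.cast_zero,
      zero_add, one_mul, Finset.sum_eq_zero, add_zero]
    · ring
    · intro s hs
      have hsa : s ≠ a := Finset.ne_of_mem_erase hs
      have hsb : s ≠ b := Finset.ne_of_mem_erase (Finset.mem_of_mem_erase hs)
      exact Finset.sum_eq_zero fun t _ => by rw [if_neg (by tauto)]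
    · intro t _ htb; rw [if_neg (by tauto)]
    · intro h; exact absurd (Finset.mem_univ b) h
    · intro t _ hta; rw [if_neg (by tauto)]
    · intro h; exact absurd (Finset.mem_univ a) h

/-- [OURS · L1 W4.6] **POLARIZATION of the quadratic form**: for every `g ∈ κ⟦X⟧` and vectors `v, v'`,
`degForm 2 g (v + v') = degForm 2 g v + degForm 2 g v' + Σₛ vₛ · degForm 1 (∂ₛ g) v'`. [folklore] -/
theorem degForm_two_add (g : MvPowerSeries (Fin n) κ) (v v' : Fin n → κ) :
    degForm 2 g (v + v') = degForm 2 g v + degForm 2 g v' + ∑ s, v s * degForm 1 (MvPowerSeries.pderiv s g) v' := by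
  -- the right-hand cross term, coefficientwise
  have hR : ∑ s, v s * degForm 1 (MvPowerSeries.pderiv s g) v' =
      ∑ s, ∑ t, ((((Finsupp.single t 1 : Fin n →₀ ℕ) s : ℕ) : κ) + 1) *
        coeff (Finsupp.single t 1 + Finsupp.single s 1) g * (v s * v' t) := by
    refine Finset.sum_congr rfl fun s _ => ?_
    rw [degForm_one_eq, Finset.mul_sum]
    refine Finset.sum_congr rfl fun t _ => ?_
    rw [MvPowerSeries.coeff_pderiv]
    ring
  -- regroup it by the exponent `e_t + e_s ∈ antidiag 2`
  set AD := (Finset.univ : Finset (Fin n)).finsuppAntidiag 2 with hAD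
  have hpick : ∀ s t : Fin n, ((((Finsupp.single t 1 : Fin n →₀ ℕ) s : ℕ) : κ) + 1) *
        coeff (Finsupp.single t 1 + Finsupp.single s 1) g * (v s * v' t) =
      ∑ A ∈ AD, coeff A g * (if Finsupp.single t 1 + Finsupp.single s 1 = A
          then ((((Finsupp.single t 1 : Fin n →₀ ℕ) s : ℕ) : κ) + 1) * (v s * v' t) else 0) := by
    intro s t
    have hmem : Finsupp.single t 1 + Finsupp.single s 1 ∈ AD :=
      mem_finsuppAntidiag_univ_iff_degree'.mpr (by rw [map_add, Finsupp.degree_single, Finsupp.degree_single])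
    simp_rw [mul_ite, mul_zero]
    rw [Finset.sum_ite_eq AD (Finsupp.single t 1 + Finsupp.single s 1)
      (fun A => coeff A g * (((((Finsupp.single t 1 : Fin n →₀ ℕ) s : ℕ) : κ) + 1) * (v s * v' t))), if_pos hmem]
    ring
  have hR' : ∑ s, ∑ t, ((((Finsupp.single t 1 : Fin n →₀ ℕ) s : ℕ) : κ) + 1) *
        coeff (Finsupp.single t 1 + Finsupp.single s 1) g * (v s * v' t) =
      ∑ A ∈ AD, coeff A g *
        ∑ s, ∑ t, (if Finsupp.single t 1 + Finsupp.single s 1 = A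
          then ((((Finsupp.single t 1 : Fin n →₀ ℕ) s : ℕ) : κ) + 1) * (v s * v' t) else 0) := by
    simp_rw [hpick]
    rw [Finset.sum_congr rfl (fun s _ => Finset.sum_comm), Finset.sum_comm]
    refine Finset.sum_congr rfl fun A _ => ?_
    rw [Finset.mul_sum]
    refine Finset.sum_congr rfl fun s _ => ?_
    rw [Finset.mul_sum]
  rw [hR, hR']
  unfold degForm
  rw [← Finset.sum_add_distrib, ← Finset.sum_add_distrib]
  refine Finset.sum_congr rfl fun A hA => ?_
  obtain ⟨a, b, rfl⟩ := exists_pair_of_degree_two (mem_finsuppAntidiag_univ_iff_degree'.mp hA)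
  rw [sum_pair_fiber, prod_pow_single_add_single, prod_pow_single_add_single, prod_pow_single_add_single]
  simp only [Pi.add_apply]
  ring

/-- [OURS · L1 W4.6] The cross term is symmetric: `Σₛ vₛ (∂ₛg)₁(v') = Σₛ v'ₛ (∂ₛg)₁(v)`. [folklore] -/
theorem polarCross_symm (g : MvPowerSeries (Fin n) κ) (v v' : Fin n → κ) :
    ∑ s, v s * degForm 1 (MvPowerSeries.pderiv s g) v' = ∑ s, v' s * degForm 1 (MvPowerSeries.pderiv s g) v := by
  have h1 := degForm_two_add g v v'
  have h2 := degForm_two_add g v' v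
  rw [add_comm v' v] at h2
  linear_combination h2 - h1

/-! ## `D_w D_w a = 0` in characteristic two -/

/-- [OURS · L1 W4.6] Characteristic two: **the second directional derivative vanishes**,
`Σₛ C wₛ ∂ₛ (Σₗ C wₗ ∂ₗ f) = 0` (`∂ₛ∂ₛ = 0` and the mixed terms cancel in pairs). [folklore] -/
theorem sum_C_mul_pderiv_sum_C_mul_pderiv_self [CharP κ 2] (f : MvPowerSeries (Fin n) κ) (w : Fin n → κ) :
    ∑ s, C (w s) * MvPowerSeries.pderiv s (∑ l, C (w l) * MvPowerSeries.pderiv l f) = 0 := by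
  have hexp : ∑ s, C (w s) * MvPowerSeries.pderiv s (∑ l, C (w l) * MvPowerSeries.pderiv l f) =
      ∑ p : Fin n × Fin n, C (w p.1) * C (w p.2) *
        MvPowerSeries.pderiv p.1 (MvPowerSeries.pderiv p.2 f) := by
    rw [Fintype.sum_prod_type]
    refine Finset.sum_congr rfl fun s _ => ?_
    rw [map_sum, Finset.mul_sum]
    refine Finset.sum_congr rfl fun l _ => ?_
    rw [Derivation.leibniz, pderiv_C, smul_zero, add_zero, smul_eq_mul]
    ring
  rw [hexp]
  refine Finset.sum_ninvolution Prod.swap (fun p => ?_) (fun p hp => ?_) (fun _ => Finset.mem_univ _)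
    (fun p => Prod.swap_swap p)
  · rw [Prod.fst_swap, Prod.snd_swap, pderiv_comm p.2 p.1,
      show C (w p.2) * C (w p.1) = C (w p.1) * C (w p.2) from mul_comm _ _, ← two_smul κ,
      show (2 : κ) = 0 from CharTwo.two_eq_zero, zero_smul]
  · intro h
    apply hp
    have : p.2 = p.1 := by rw [Prod.ext_iff] at h; exact h.1
    rw [this, pderiv_pderiv_self, mul_zero]

/-- [OURS · L1 W4.6] Characteristic two: **`T(w, w, x) = 0`** — the cross term of the quadratic form of
`D_w a` between `w` and `x` vanishes: `Σₛ wₛ · degForm 1 (∂ₛ (Σₗ C wₗ ∂ₗ f)) x = 0`. [folklore] -/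
theorem polarCross_self_eq_zero [CharP κ 2] (f : MvPowerSeries (Fin n) κ) (w x : Fin n → κ) :
    ∑ s, w s * degForm 1 (MvPowerSeries.pderiv s (∑ l, C (w l) * MvPowerSeries.pderiv l f)) x = 0 := by
  have h : ∑ s, w s * degForm 1 (MvPowerSeries.pderiv s (∑ l, C (w l) * MvPowerSeries.pderiv l f)) x =
      degForm 1 (∑ s, C (w s) * MvPowerSeries.pderiv s (∑ l, C (w l) * MvPowerSeries.pderiv l f)) x := by
    rw [degForm_sum]
    exact Finset.sum_congr rfl fun s _ => (degForm_C_mul _ _ _ _).symm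
  rw [h, sum_C_mul_pderiv_sum_C_mul_pderiv_self, degForm_zero']

/-- [OURS · L1 W4.6] **The trilinear form is symmetric in its first two slots**:
`Σₛ vₛ (∂ₛ D_λ f)₁(x) = Σₛ λₛ (∂ₛ D_v f)₁(x)` (mixed partials commute). [folklore] -/
theorem polarCross_comm (f : MvPowerSeries (Fin n) κ) (lam v x : Fin n → κ) :
    ∑ s, v s * degForm 1 (MvPowerSeries.pderiv s (∑ l, C (lam l) * MvPowerSeries.pderiv l f)) x =
      ∑ s, lam s * degForm 1 (MvPowerSeries.pderiv s (∑ l, C (v l) * MvPowerSeries.pderiv l f)) x := by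
  have hexp : ∀ a b : Fin n → κ,
      ∑ s, a s * degForm 1 (MvPowerSeries.pderiv s (∑ l, C (b l) * MvPowerSeries.pderiv l f)) x =
        ∑ s, ∑ l, a s * b l * degForm 1 (MvPowerSeries.pderiv s (MvPowerSeries.pderiv l f)) x := by
    intro a b
    refine Finset.sum_congr rfl fun s _ => ?_
    rw [map_sum, degForm_sum, Finset.mul_sum]
    refine Finset.sum_congr rfl fun l _ => ?_
    rw [Derivation.leibniz, pderiv_C, smul_zero, add_zero, smul_eq_mul, degForm_C_mul]
    ring
  rw [hexp, hexp, Finset.sum_comm]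
  refine Finset.sum_congr rfl fun l _ => Finset.sum_congr rfl fun s _ => ?_
  rw [pderiv_comm l s]
  ring

/-! ## Two satellites force `h₂ = 3` -/

/-- [OURS · L1 W4.6 rung (ii) at `p = 2`, every dimension; NOT a statement of the manuscript] **TWO
NON-PROPORTIONAL SATELLITE DIRECTIONS FORCE `h₂ = 3`.** Let `c` be a double state of `z² = a(u₁,…,uₙ)`
(any field of characteristic `2`) with `e(c) = 2`, and `w₁, w₂` two non-proportional kernel vectors of the
polar form which are both SINGULAR points of the tangent cubic on the kernel plane (all kernel polars
vanish at `w₁` and at `w₂`). Then all polars vanish on the kernel and `h₂(c) = 3` — the «no tangent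
cubic» class. [folklore] -/
theorem hypersurface_two_satellites_milnorHilbertTwo_eq_three [CharP κ 2] (c : (Fin n → ℕ) → κ)
    (hM : MultP 2 n κ c) (he : milnorEmbDim 2 n κ c = 2) {w₁ w₂ : Fin n → κ} (hw₁0 : w₁ ≠ 0)
    (hw₁ : Matrix.vecMul w₁ (polarMatrix (ser 2 n κ c)) = 0)
    (hw₂ : Matrix.vecMul w₂ (polarMatrix (ser 2 n κ c)) = 0) (hnot : ∀ r : κ, w₂ ≠ r • w₁)
    (hs₁ : ∀ v : Fin n → κ, Matrix.vecMul v (polarMatrix (ser 2 n κ c)) = 0 →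
      ∑ l, v l * degForm 2 (MvPowerSeries.pderiv l (ser 2 n κ c)) w₁ = 0)
    (hs₂ : ∀ v : Fin n → κ, Matrix.vecMul v (polarMatrix (ser 2 n κ c)) = 0 →
      ∑ l, v l * degForm 2 (MvPowerSeries.pderiv l (ser 2 n κ c)) w₂ = 0) :
    milnorHilbertTwo 2 n κ c = 3 := by
  set f := ser 2 n κ c with hfdef
  refine hypersurface_milnorHilbertTwo_eq_three_of_polar_eq_zero c hM he fun lam v hlam hv => ?_
  -- the polar as the quadratic form of `D_λ f`
  set D : MvPowerSeries (Fin n) κ := ∑ l, C (lam l) * MvPowerSeries.pderiv l f with hD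
  have hDq : ∀ y : Fin n → κ, degForm 2 D y = ∑ l, lam l * degForm 2 (MvPowerSeries.pderiv l f) y :=
    fun y => degForm_two_sum_C_mul_pderiv f lam y
  -- the cross term `T(λ, w₁, w₂)` vanishes for `λ ∈ K = ⟨w₁, w₂⟩`
  have hcross : ∑ s, w₁ s * degForm 1 (MvPowerSeries.pderiv s D) w₂ = 0 := by
    obtain ⟨α, β, hαβ⟩ := kernel_span_pair hM he hw₁0 hw₁ hw₂ hnot lam hlam
    have hDsplit : D = C α * (∑ l, C (w₁ l) * MvPowerSeries.pderiv l f) +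
        C β * (∑ l, C (w₂ l) * MvPowerSeries.pderiv l f) := by
      rw [hD, ← hαβ, Finset.mul_sum, Finset.mul_sum, ← Finset.sum_add_distrib]
      refine Finset.sum_congr rfl fun l _ => ?_
      rw [Pi.add_apply, Pi.smul_apply, Pi.smul_apply, smul_eq_mul, smul_eq_mul, map_add, map_mul, map_mul]
      ring
    have hlin : ∀ (G H : MvPowerSeries (Fin n) κ) (r t : κ),
        ∑ s, w₁ s * degForm 1 (MvPowerSeries.pderiv s (C r * G + C t * H)) w₂ =
          r * ∑ s, w₁ s * degForm 1 (MvPowerSeries.pderiv s G) w₂ +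
            t * ∑ s, w₁ s * degForm 1 (MvPowerSeries.pderiv s H) w₂ := by
      intro G H r t
      rw [Finset.mul_sum, Finset.mul_sum, ← Finset.sum_add_distrib]
      refine Finset.sum_congr rfl fun s _ => ?_
      rw [map_add, Derivation.leibniz, pderiv_C, smul_zero, add_zero, smul_eq_mul, Derivation.leibniz, pderiv_C,
        smul_zero, add_zero, smul_eq_mul, degForm_add, degForm_C_mul, degForm_C_mul]
      ring
    rw [hDsplit, hlin, polarCross_self_eq_zero f w₁ w₂, mul_zero, zero_add,
      polarCross_symm _ w₁ w₂, polarCross_self_eq_zero f w₂ w₁, mul_zero]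
  -- expand `v = a w₁ + b w₂` by polarization
  obtain ⟨a, b, hab⟩ := kernel_span_pair hM he hw₁0 hw₁ hw₂ hnot v hv
  rw [← hDq, ← hab, degForm_two_add, degForm_smul_vec, degForm_smul_vec, hDq, hDq, hs₁ lam hlam, hs₂ lam hlam,
    mul_zero, mul_zero, zero_add, zero_add]
  have hcross' : ∑ s, (a • w₁) s * degForm 1 (MvPowerSeries.pderiv s D) (b • w₂) =
      a * b * ∑ s, w₁ s * degForm 1 (MvPowerSeries.pderiv s D) w₂ := by
    rw [Finset.mul_sum]
    refine Finset.sum_congr rfl fun s _ => ?_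
    rw [Pi.smul_apply, smul_eq_mul, degForm_smul_vec, pow_one]
    ring
  rw [hcross', hcross, mul_zero]

/-- [OURS · L1 W4.6 rung (ii) at `p = 2`, every dimension; NOT a statement of the manuscript] **AT MOST ONE
SATELLITE**: for a double state with `e(c) = 2` and `h₂(c) ≤ 2`, any two kernel vectors at which all kernel
polars of the tangent cubic vanish are PROPORTIONAL — the singular directions of the kernel cubic form at
most one point of the kernel line `ℙ¹`; by `hypersurface_milnorEmbDim_step_eq_two_iff` (p533887) the
corank-two chain of infinitely-near double points continues at AT MOST ONE near point (all other near
points are free: successor `μ = 1`). [folklore] -/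
theorem hypersurface_satellite_unique [CharP κ 2] (c : (Fin n → ℕ) → κ) (hM : MultP 2 n κ c)
    (he : milnorEmbDim 2 n κ c = 2) (hh : milnorHilbertTwo 2 n κ c ≤ 2) {w₁ w₂ : Fin n → κ}
    (hw₁0 : w₁ ≠ 0) (hw₁ : Matrix.vecMul w₁ (polarMatrix (ser 2 n κ c)) = 0)
    (hw₂ : Matrix.vecMul w₂ (polarMatrix (ser 2 n κ c)) = 0)
    (hs₁ : ∀ v : Fin n → κ, Matrix.vecMul v (polarMatrix (ser 2 n κ c)) = 0 →
      ∑ l, v l * degForm 2 (MvPowerSeries.pderiv l (ser 2 n κ c)) w₁ = 0)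
    (hs₂ : ∀ v : Fin n → κ, Matrix.vecMul v (polarMatrix (ser 2 n κ c)) = 0 →
      ∑ l, v l * degForm 2 (MvPowerSeries.pderiv l (ser 2 n κ c)) w₂ = 0) :
    ∃ r : κ, w₂ = r • w₁ := by
  by_contra h
  push Not at h
  have h3 := hypersurface_two_satellites_milnorHilbertTwo_eq_three c hM he hw₁0 hw₁ hw₂ h hs₁ hs₂
  omega

/-- [OURS · L1 W4.6 rung (ii) at `p = 2`, every dimension; NOT a statement of the manuscript] **NO
SATELLITE AT `h₂ = 1`**: for an isolated double state with `e(c) = 2`, `h₂(c) = 1` (the `D₄` class), no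
non-zero kernel vector is a singular point of the kernel cubic: such a direction would be a near point with
corank-two successor (p533887), while every double successor has `e = 0` (gen 4,
`hypersurface_regime_step_of_milnorHilbertTwo_eq_one`). All near points are free. [folklore] -/
theorem hypersurface_no_satellite_of_milnorHilbertTwo_eq_one [CharP κ 2] (c : (Fin n → ℕ) → κ)
    (hM : MultP 2 n κ c) (hI : Isol 2 n κ c) (he : milnorEmbDim 2 n κ c = 2)
    (hh : milnorHilbertTwo 2 n κ c = 1) {lam : Fin n → κ}
    (hlam : Matrix.vecMul lam (polarMatrix (ser 2 n κ c)) = 0)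
    (hsing : ∀ v : Fin n → κ, Matrix.vecMul v (polarMatrix (ser 2 n κ c)) = 0 →
      ∑ l, v l * degForm 2 (MvPowerSeries.pderiv l (ser 2 n κ c)) lam = 0) :
    lam = 0 := by
  by_contra h0
  obtain ⟨i, hi⟩ : ∃ i, lam i ≠ 0 := by
    by_contra h
    push Not at h
    exact h0 (funext h)
  obtain ⟨hM', he'⟩ := hypersurface_singular_direction_corank_two c hM hI he hi hlam hsing
  have h := (hypersurface_regime_step_of_milnorHilbertTwo_eq_one c i _ hM he hh hM').1
  omega

end CampaignW46.HypersurfacesCharTwo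

end Summit.ResolutionOfSingularities.ResolutionOfSingularities.Theorems

end
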